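import Summits.HodgeConjecture.HodgeConjecture.Theorems.NikulinTwinTransportEEightTwoSimilitude
import Literature.AlgebraicGeometry.Surfaces.K3NikulinInvolution
import Literature.AlgebraicGeometry.Surfaces.K3SurfaceProofs
import Literature.AlgebraicGeometry.Surfaces.K3HodgeTypes
import Literature.AlgebraicGeometry.HodgeTheory.ComplexConjugation

/-!
# Crux `NikulinSerreCarrier` · line `neron-severi-intertwiner` · stub `stub_nikulinAnchorFrame` (S1) —
# the `A₁⁸` FRAME `r_1, …, r_8` of the anti-invariant lattice `E₈(−2)` of a Nikulin involution

Helper file (`--supports stmt-HodgeConjecture-14464`) for the anchor stub `stub_nikulinAnchorFrame`. The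
completed Nikulin similitude `Ψ = g^* ⊕ (N_j ↦ r_j)` of the anchor sends the eight nodal classes `N_j` of
the resolved quotient to eight pairwise orthogonal `(−4)`-classes `r_j` spanning the anti-invariant
lattice `(H²(X, ℤ)^ι)^⊥ ≅ E₈(−2)` of the Nikulin involution `ι` (van Geemen–Sarti 2007 §1.3; the frame
is the `A₁⁸` frame of `E₈`, route item `EEightTwoSimilitude`, PROVED:
`Theorems/NikulinTwinTransportEEightTwoSimilitude.lean`, conjunct (1): an integer matrix `R` with
`Rᵀ E₈ R = 2·1`). This file produces the frame ON THE SUMMIT CARRIER `H²(X(ℂ); ℂ)` of a projective K3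
surface `X` with a Nikulin involution `ι`, CONDITIONALLY on the tree's named fact
`Nikulin_involution_marking` (van Geemen–Sarti §1.2 / Morrison Thm. 5.7: a marking
`φ : H²(X(ℂ); ℂ) ≅ Λ_ℂ` in which `ι^*` is the swap of the two `E₈(−1)` blocks):
* lattice lemmas on `Λ_ℂ = ℂ^{K3Index}`: the block swap is a `k3Form`-isometry
  (`k3Form_comp_k3BlockSwap`), anti-invariant vectors are orthogonal to invariant ones
  (`k3Form_eq_zero_of_anti_of_inv`); the block vectors `(R_j, −R_j, 0)` (written out, no new
  definition) are swap-anti-invariant, pairwise orthogonal of square `−4` (`k3Form_frame`), and span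
  the swap-anti-invariant vectors (`mem_span_frame_of_anti`: `R` is invertible over `ℂ`);
* `exists_antiInvariantFrame`: for `IsK3Surface X`, `IsNikulinInvolution X ι`, granted the fact, a
  marking `(φ, p)` of `X` with the swap property together with integral classes `r_1, …, r_8` such that
  `ι^* r_j = −r_j`, `r_i ∪ r_j = −4δ_ij p`, every `ι^*`-anti-invariant class is a `ℂ`-combination of the
  `r_j`, and `(φ r_j.φ w) = 0 = (φ w.φ r_j)` for every `ι^*`-invariant `w`;
* `isOfHodgeType_oneOne_of_anti`: every `ι^*`-anti-invariant class is of Hodge type `(1,1)`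
  (van Geemen–Sarti §2.1: `(H²(X,ℤ)^ι)^⊥ ⊂ NS(X)`, as `ι^*ω = ω`), granted in addition the named facts
  `Huybrechts_K3_marking_exists` (a non-zero `(2,0)`-class) and `Huybrechts_K3_hodgeTypes_H2`
  (`H^{1,1} = ⟨σ, σ̄⟩^⊥`).
-/

noncomputable section

-- the doubled component `HodgeConjecture.HodgeConjecture` is the summit/problem layout (D-0022), not a slip
set_option linter.dupNamespace false

namespace Summit.HodgeConjecture.HodgeConjecture.Theorems.NikulinSerreCarrier.NeronSeveriIntertwiner

open scoped BigOperators Matrix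
open CategoryTheory
open Literature.AlgebraicGeometry Literature.AlgebraicGeometry.HodgeTheory
open Literature.AlgebraicGeometry.Surfaces
open Literature.AlgebraicTopology.SingularHomology

/-- The `j`-th frame vector `(R_j, −R_j, 0) ∈ Λ = E₈(−1) ⊕ E₈(−1) ⊕ U^{⊕3}` (integer coordinates) of an
`8 × 8` integer matrix `R`. Local notation only. -/
local notation3 "frameZ[" R ", " j "]" =>
  (Sum.elim (Sum.elim (fun a ↦ (R : Matrix (Fin 8) (Fin 8) ℤ) a j) (fun a ↦ -(R : Matrix (Fin 8) (Fin 8) ℤ) a j))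
    0 : K3Index → ℤ)

/-- The `j`-th frame vector with complex coordinates. Local notation only. -/
local notation3 "frameC[" R ", " j "]" => (fun i ↦ ((frameZ[R, j] i : ℤ) : ℂ) : K3Index → ℂ)

/-! ### Lattice lemmas on `Λ_ℂ = ℂ^{K3Index}`, `K3Index = (Fin 8 ⊕ Fin 8) ⊕ (Fin 2 ⊕ Fin 2 ⊕ Fin 2)` -/

/-- **The block swap is an isometry of the `ℂ`-bilinear K3 form**: `(a∘swap . b∘swap) = (a.b)`
(reindex the double sum by the involution; `k3Gram_k3BlockSwap`). [cite: VanGeemenSarti2007, §1.2] -/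
theorem k3Form_comp_k3BlockSwap (a b : K3Index → ℂ) :
    k3Form (fun i ↦ a (k3BlockSwap i)) (fun i ↦ b (k3BlockSwap i)) = k3Form a b := by
  let σ : Equiv.Perm K3Index := Function.Involutive.toPerm k3BlockSwap k3BlockSwap_k3BlockSwap
  simp only [k3Form]
  refine Fintype.sum_equiv σ _ _ fun i ↦ Fintype.sum_equiv σ _ _ fun j ↦ ?_
  change a (k3BlockSwap i) * (k3Gram i j : ℂ) * b (k3BlockSwap j) =
    a (k3BlockSwap i) * (k3Gram (k3BlockSwap i) (k3BlockSwap j) : ℂ) * b (k3BlockSwap j)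
  rw [k3Gram_k3BlockSwap]

/-- **Anti-invariant and invariant vectors are orthogonal**: if `v ∘ swap = −v` and `w ∘ swap = w`,
then `(v.w) = 0`, since `(v.w) = (v∘swap . w∘swap) = (−v.w)` (van Geemen–Sarti §1.3: the anti-invariant
lattice is the orthogonal complement of the invariant lattice). [cite: VanGeemenSarti2007, §1.3] -/
theorem k3Form_eq_zero_of_anti_of_inv {v w : K3Index → ℂ} (hv : ∀ i, v (k3BlockSwap i) = -v i)
    (hw : ∀ i, w (k3BlockSwap i) = w i) : k3Form v w = 0 := by
  have h : k3Form v w = -k3Form v w := by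
    conv_lhs => rw [← k3Form_comp_k3BlockSwap v w]
    have h1 : (fun i ↦ v (k3BlockSwap i)) = (-1 : ℂ) • v := by
      funext i; rw [hv i, Pi.smul_apply, smul_eq_mul, neg_one_mul]
    have h2 : (fun i ↦ w (k3BlockSwap i)) = w := funext hw
    rw [h1, h2, k3Form_smul_left, neg_one_mul]
  have h2 : (2 : ℂ) * k3Form v w = 0 := by
    rw [two_mul]
    nth_rw 2 [h]
    exact add_neg_cancel _
  exact (mul_eq_zero.1 h2).resolve_left two_ne_zero

/-- The frame vectors `(R_j, −R_j, 0)` are anti-invariant under the block swap `(u, x, y) ↦ (u, y, x)`.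
[cite: VanGeemenSarti2007, §1.3] -/
theorem frame_k3BlockSwap (R : Matrix (Fin 8) (Fin 8) ℤ) (j : Fin 8) (i : K3Index) :
    frameC[R, j] (k3BlockSwap i) = -frameC[R, j] i := by
  rcases i with (a | a) | b <;> simp [k3BlockSwap]

/-- The K3 form of two vectors supported on the `E₈(−1)^{⊕2}` block is the `E₈(−1) ⊕ E₈(−1)` form of
their block coordinates. [cite: Huybrechts2016K3, Ch. 1 §3.3] -/
theorem k3Form_sumElim_zero (u v : Fin 8 ⊕ Fin 8 → ℂ) :
    k3Form (Sum.elim u 0) (Sum.elim v 0) =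
      ∑ a, ∑ b, u a * ((Matrix.fromBlocks (-CartanMatrix.E₈) 0 0 (-CartanMatrix.E₈) :
        Matrix (Fin 8 ⊕ Fin 8) (Fin 8 ⊕ Fin 8) ℤ) a b : ℂ) * v b := by
  simp [k3Form, k3Gram, Fintype.sum_sum_type]

/-- **The Gram matrix of the frame**: `((R_i, −R_i, 0).(R_j, −R_j, 0)) = −2 (Rᵀ E₈ R)_{ij}` — both
`E₈(−1)` blocks contribute `−(Rᵀ E₈ R)_{ij}` (the anti-invariant lattice is `E₈(−2)`, §1.3).
[cite: VanGeemenSarti2007, §1.3] -/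
theorem k3Form_frame_eq (R : Matrix (Fin 8) (Fin 8) ℤ) (i j : Fin 8) :
    k3Form frameC[R, i] frameC[R, j] = -2 * ((Rᵀ * CartanMatrix.E₈ * R) i j : ℂ) := by
  have hi : frameC[R, i] = Sum.elim (Sum.elim (fun a ↦ (R a i : ℂ)) (fun a ↦ -(R a i : ℂ))) 0 := by
    funext x; rcases x with (a | a) | b <;> simp
  have hj : frameC[R, j] = Sum.elim (Sum.elim (fun a ↦ (R a j : ℂ)) (fun a ↦ -(R a j : ℂ))) 0 := by
    funext x; rcases x with (a | a) | b <;> simp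
  rw [hi, hj, k3Form_sumElim_zero]
  simp only [Fintype.sum_sum_type, Sum.elim_inl, Sum.elim_inr, Matrix.fromBlocks_apply₁₁,
    Matrix.fromBlocks_apply₁₂, Matrix.fromBlocks_apply₂₁, Matrix.fromBlocks_apply₂₂, Matrix.zero_apply,
    Matrix.neg_apply, Int.cast_zero, Int.cast_neg, mul_zero, zero_mul, Finset.sum_const_zero, add_zero,
    zero_add]
  have hRHS : -2 * ((Rᵀ * CartanMatrix.E₈ * R) i j : ℂ) =
      ∑ a, ∑ b, -2 * ((R a i : ℂ) * (CartanMatrix.E₈ a b : ℂ) * (R b j : ℂ)) := by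
    simp only [Matrix.mul_apply, Matrix.transpose_apply, Int.cast_sum, Int.cast_mul, Finset.mul_sum,
      Finset.sum_mul]
    exact Finset.sum_comm
  rw [hRHS, ← Finset.sum_add_distrib]
  refine Finset.sum_congr rfl fun a _ ↦ ?_
  rw [← Finset.sum_add_distrib]
  refine Finset.sum_congr rfl fun b _ ↦ ?_
  ring

/-- **The frame is an `A₁⁸(−2)`-configuration in `E₈(−2)`**: for an `A₁⁸` frame of `E₈` (`Rᵀ E₈ R = 2·1`,
route item `EEightTwoSimilitude`) the frame vectors are pairwise orthogonal of square `−4`.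
[cite: VanGeemenSarti2007, §1.3] -/
theorem k3Form_frame {R : Matrix (Fin 8) (Fin 8) ℤ}
    (hR : Rᵀ * CartanMatrix.E₈ * R = 2 • (1 : Matrix (Fin 8) (Fin 8) ℤ)) (i j : Fin 8) :
    k3Form frameC[R, i] frameC[R, j] = if i = j then -4 else 0 := by
  rw [k3Form_frame_eq, hR, Matrix.smul_apply, Matrix.one_apply]
  split_ifs <;> norm_num

/-- An `A₁⁸` frame matrix is invertible over `ℂ`: `(½ Rᵀ E₈) R = 1`. [folklore] -/
theorem frame_leftInverse {R : Matrix (Fin 8) (Fin 8) ℤ}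
    (hR : Rᵀ * CartanMatrix.E₈ * R = 2 • (1 : Matrix (Fin 8) (Fin 8) ℤ)) :
    ((2 : ℂ)⁻¹ • (Rᵀ * CartanMatrix.E₈).map (Int.castRingHom ℂ)) * R.map (Int.castRingHom ℂ) = 1 := by
  rw [Matrix.smul_mul, ← Matrix.map_mul, hR]
  ext a b
  rw [Matrix.smul_apply, Matrix.map_apply, Matrix.smul_apply, Matrix.one_apply, Matrix.one_apply]
  split_ifs <;> simp

/-- **The frame spans the anti-invariant vectors**: every `v ∈ Λ_ℂ` with `v ∘ swap = −v` (so `v` has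
the shape `(u, −u, 0)`) is a `ℂ`-combination of the frame vectors `(R_j, −R_j, 0)`, because an `A₁⁸`
frame matrix `R` is invertible (§1.3: the anti-invariant lattice `{(0, x, −x)} ≅ E₈(−2)` has rank `8`).
[cite: VanGeemenSarti2007, §1.3] -/
theorem mem_span_frame_of_anti {R : Matrix (Fin 8) (Fin 8) ℤ}
    (hR : Rᵀ * CartanMatrix.E₈ * R = 2 • (1 : Matrix (Fin 8) (Fin 8) ℤ)) {v : K3Index → ℂ}
    (hv : ∀ i, v (k3BlockSwap i) = -v i) : v ∈ Submodule.span ℂ (Set.range fun j ↦ frameC[R, j]) := by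
  have hLR := frame_leftInverse hR
  have hRL := mul_eq_one_comm.1 hLR
  -- the shape of `v`: `(u, −u, 0)`
  have hv1 : ∀ a, v (Sum.inl (Sum.inr a)) = -v (Sum.inl (Sum.inl a)) := fun a ↦ by
    have := hv (Sum.inl (Sum.inl a))
    simpa [k3BlockSwap] using this
  have hv2 : ∀ b, v (Sum.inr b) = 0 := fun b ↦ by
    have h := hv (Sum.inr b)
    simp only [k3BlockSwap, Sum.map_inr, id_eq] at h
    have h2 : (2 : ℂ) * v (Sum.inr b) = 0 := by
      rw [two_mul]
      nth_rw 2 [h]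
      exact add_neg_cancel _
    exact (mul_eq_zero.1 h2).resolve_left two_ne_zero
  -- coefficients `c = (½ Rᵀ E₈) u`, so that `R c = u`
  let u : Fin 8 → ℂ := fun a ↦ v (Sum.inl (Sum.inl a))
  let c : Fin 8 → ℂ := ((2 : ℂ)⁻¹ • (Rᵀ * CartanMatrix.E₈).map (Int.castRingHom ℂ)).mulVec u
  have hRc : (R.map (Int.castRingHom ℂ)).mulVec c = u := by
    change (R.map (Int.castRingHom ℂ)).mulVec ((_ : Matrix (Fin 8) (Fin 8) ℂ).mulVec u) = u
    rw [Matrix.mulVec_mulVec, hRL, Matrix.one_mulVec]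
  have hRc' : ∀ a, ∑ j, (R a j : ℂ) * c j = v (Sum.inl (Sum.inl a)) := fun a ↦ by
    have h := congrFun hRc a
    simpa [Matrix.mulVec, dotProduct] using h
  rw [Submodule.mem_span_range_iff_exists_fun]
  refine ⟨c, ?_⟩
  funext x
  rw [Finset.sum_apply]
  simp only [Pi.smul_apply, smul_eq_mul]
  rcases x with (a | a) | b
  · rw [← hRc' a]
    exact Finset.sum_congr rfl fun j _ ↦ by simp [mul_comm]
  · rw [hv1 a, ← hRc' a, ← Finset.sum_neg_distrib]
    exact Finset.sum_congr rfl fun j _ ↦ by simp [mul_comm]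
  · rw [hv2 b]
    exact Finset.sum_eq_zero fun j _ ↦ by simp

/-! ### The frame on `H²(X(ℂ); ℂ)` of a K3 surface with a Nikulin involution -/

variable {X : Motives.SchemeOver ℂ} {ι : X ⟶ X}

/-- In a marking `φ` in which `ι^*` is the block swap, a class `x` is `ι^*`-ANTI-invariant iff its
coordinate vector is anti-invariant under the swap (companion of
`Nikulin_involution_marking.map_eq_self_iff`). [cite: VanGeemenSarti2007, §1.3] -/
theorem map_eq_neg_iff_of_marking (φ : complexBetti X (2 * 1) ≃ₗ[ℂ] (K3Index → ℂ))
    (hφ : ∀ c : complexBetti X (2 * 1), φ (complexBetti.map ι (2 * 1) c) = fun i ↦ φ c (k3BlockSwap i))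
    (x : complexBetti X (2 * 1)) :
    complexBetti.map ι (2 * 1) x = -x ↔ ∀ i, φ x (k3BlockSwap i) = -φ x i := by
  constructor
  · intro h i
    have := congrFun (hφ x) i
    rw [h, map_neg] at this
    exact this.symm
  · intro h
    apply φ.injective
    rw [hφ x, map_neg]
    funext i
    exact h i

/-- **The `A₁⁸` frame of the anti-invariant lattice of a Nikulin involution, on the summit carrier.**
For a projective K3 surface `X` with a Nikulin involution `ι`, GRANTED the named fact
`Nikulin_involution_marking` (van Geemen–Sarti §1.2 / Morrison Thm. 5.7), there are a marking `(φ, p)` of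
`X` (integral classes `↔ ℤ²²`, `a ∪ b = (φa.φb) p`, `p` an integral generator of `H⁴`) in which `ι^*` is
the block swap, and eight INTEGRAL classes `r_1, …, r_8 ∈ H²(X(ℂ); ℂ)` — the images of the `A₁⁸` frame of
`E₈` (route item `EEightTwoSimilitude`, proved) in the anti-invariant lattice `E₈(−2)` — with
`ι^* r_j = −r_j`, `(φ r_i.φ r_j) = −4 δ_ij` (so `r_i ∪ r_j = −4δ_ij p`), spanning the `ι^*`-anti-invariant
classes over `ℂ`, and orthogonal to every `ι^*`-invariant class. [cite: VanGeemenSarti2007, §1.2 and §1.3]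
[cite: Morrison1984, Thm. 5.7] -/
theorem exists_antiInvariantFrame (hNM : Nikulin_involution_marking) (hX : IsK3Surface X)
    (hι : IsNikulinInvolution X ι) :
    ∃ (φ : complexBetti X (2 * 1) ≃ₗ[ℂ] (K3Index → ℂ)) (p : complexBetti X (2 * 2))
      (r : Fin 8 → complexBetti X (2 * 1)),
      (IsIntegralClass p ∧
        (∀ q : complexBetti X (2 * 2), IsIntegralClass q → ∃ n : ℤ, q = n • p) ∧
        (∀ c : complexBetti X (2 * 1), IsIntegralClass c ↔ ∃ v : K3Index → ℤ, φ c = fun i ↦ (v i : ℂ)) ∧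
        (∀ a b : complexBetti X (2 * 1),
          cupProduct (rfl : 2 * 1 + 2 * 1 = 2 * 2) a b = k3Form (φ a) (φ b) • p) ∧
        ∀ c : complexBetti X (2 * 1),
          φ (complexBetti.map ι (2 * 1) c) = fun i ↦ φ c (k3BlockSwap i)) ∧
      (∀ j, IsIntegralClass (r j)) ∧
      (∀ j, complexBetti.map ι (2 * 1) (r j) = -r j) ∧
      (∀ i j, k3Form (φ (r i)) (φ (r j)) = if i = j then -4 else 0) ∧
      (∀ i j, cupProduct (rfl : 2 * 1 + 2 * 1 = 2 * 2) (r i) (r j) = (if i = j then (-4 : ℂ) else 0) • p) ∧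
      (∀ x : complexBetti X (2 * 1), complexBetti.map ι (2 * 1) x = -x →
        x ∈ Submodule.span ℂ (Set.range r)) ∧
      (∀ (j) (w : complexBetti X (2 * 1)), complexBetti.map ι (2 * 1) w = w →
        k3Form (φ (r j)) (φ w) = 0 ∧ k3Form (φ w) (φ (r j)) = 0) := by
  obtain ⟨φ, p, hp, hgen, hint, hcup, hswap⟩ := hNM X hX ι hι
  obtain ⟨⟨R, hR, -⟩, -⟩ := eEightTwoSimilitude_proof
  refine ⟨φ, p, fun j ↦ φ.symm frameC[R, j], ⟨hp, hgen, hint, hcup, hswap⟩, ?_, ?_, ?_, ?_, ?_, ?_⟩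
  · -- integral
    intro j
    exact (hint _).2 ⟨frameZ[R, j], by rw [LinearEquiv.apply_symm_apply]⟩
  · -- anti-invariant
    intro j
    rw [map_eq_neg_iff_of_marking φ hswap]
    intro i
    rw [LinearEquiv.apply_symm_apply]
    exact frame_k3BlockSwap R j i
  · intro i j
    rw [LinearEquiv.apply_symm_apply, LinearEquiv.apply_symm_apply]
    exact k3Form_frame hR i j
  · intro i j
    rw [hcup, LinearEquiv.apply_symm_apply, LinearEquiv.apply_symm_apply, k3Form_frame hR i j]
  · -- spanning
    intro x hx
    have hv : ∀ i, φ x (k3BlockSwap i) = -φ x i := (map_eq_neg_iff_of_marking φ hswap x).1 hx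
    obtain ⟨c, hc⟩ := (Submodule.mem_span_range_iff_exists_fun ℂ).1 (mem_span_frame_of_anti hR hv)
    have hx' : x = ∑ j, c j • φ.symm frameC[R, j] := by
      apply φ.injective
      rw [← hc, map_sum]
      exact Finset.sum_congr rfl fun j _ ↦ by rw [map_smul, LinearEquiv.apply_symm_apply]
    rw [hx']
    exact Submodule.sum_mem _ fun j _ ↦ Submodule.smul_mem _ _ (Submodule.subset_span ⟨j, rfl⟩)
  · -- orthogonal to invariants
    intro j w hw
    have hw' : ∀ i, φ w (k3BlockSwap i) = φ w i :=
      (Nikulin_involution_marking.map_eq_self_iff φ hswap w).1 hw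
    have hv : ∀ i, frameC[R, j] (k3BlockSwap i) = -frameC[R, j] i := frame_k3BlockSwap R j
    rw [LinearEquiv.apply_symm_apply]
    exact ⟨k3Form_eq_zero_of_anti_of_inv hv hw',
      by rw [k3Form_comm]; exact k3Form_eq_zero_of_anti_of_inv hv hw'⟩

/-- **Anti-invariant classes of a Nikulin involution are of type `(1,1)`** (van Geemen–Sarti §2.1:
"for `x ∈ (H²(X,ℤ)^ι)^⊥` we have `ι^*x = −x`; as `ι^*ω = ω` for `ω ∈ H^{2,0}(X)` we get
`ω·x = ι^*ω·ι^*x = −ω·x`, hence `(H²(X,ℤ)^ι)^⊥ ⊂ NS(X)`"). On the summit carrier, GRANTED the named facts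
`Nikulin_involution_marking` (the swap marking, through which `x ∪ w = 0` for `x` anti-invariant and `w`
invariant), `Huybrechts_K3_marking_exists` (a non-zero `(2,0)`-class `σ`) and
`Huybrechts_K3_hodgeTypes_H2` (`H^{1,1} = ⟨σ, σ̄⟩^⊥`): `σ` is `ι^*`-invariant because `ι` is symplectic,
`σ̄` because conjugation commutes with `ι^*`, so an anti-invariant `x` is orthogonal to both.
[cite: VanGeemenSarti2007, §2.1] [cite: Huybrechts2016K3, Ch. 6 Prop. 1.2 (iii)] -/
theorem isOfHodgeType_oneOne_of_anti (hNM : Nikulin_involution_marking) (hMk : Huybrechts_K3_marking_exists)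
    (hHT : Huybrechts_K3_hodgeTypes_H2) (hX : IsK3Surface X) (hι : IsNikulinInvolution X ι)
    {x : complexBetti X (2 * 1)} (hx : complexBetti.map ι (2 * 1) x = -x) :
    IsOfHodgeType 2 X (2 * 1) 1 1 x := by
  obtain ⟨φ, p, hp, hgen, hint, hcup, hswap⟩ := hNM X hX ι hι
  obtain ⟨σ, hσ0, hσ⟩ := hMk.exists_twoZero_ne_zero hX
  -- `σ` and `σ̄` are `ι^*`-invariant
  have hσinv : complexBetti.map ι (2 * 1) σ = σ := hι.isSymplectic σ hσ
  have hσbar : complexBetti.map ι (2 * 1) (conjClass (Motives.ComplexPoints X) (2 * 1) σ) =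
      conjClass (Motives.ComplexPoints X) (2 * 1) σ := by
    rw [complexBetti.map, ← conjClass_map]
    change conjClass _ _ (complexBetti.map ι (2 * 1) σ) = _
    rw [hσinv]
  -- an anti-invariant class is orthogonal to every invariant class
  have horth : ∀ w : complexBetti X (2 * 1), complexBetti.map ι (2 * 1) w = w →
      cupProduct (rfl : 2 * 1 + 2 * 1 = 2 * 2) x w = 0 := by
    intro w hw
    have hv : ∀ i, φ x (k3BlockSwap i) = -φ x i := (map_eq_neg_iff_of_marking φ hswap x).1 hx
    have hw' : ∀ i, φ w (k3BlockSwap i) = φ w i :=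
      (Nikulin_involution_marking.map_eq_self_iff φ hswap w).1 hw
    rw [hcup, k3Form_eq_zero_of_anti_of_inv hv hw', zero_smul]
  exact ((hHT X hX σ hσ hσ0).2.2 x).2 ⟨horth σ hσinv, horth _ hσbar⟩

/-- **Registered stub `stub_anchorAntiInvariantFrame`** (crux item stmt-HodgeConjecture-14464, line
`neron-severi-intertwiner`, sub-goal of `stub_nikulinAnchorFrame`): the `A₁⁸` frame of the anti-invariant lattice
of a Nikulin involution on the summit carrier, granted `Nikulin_involution_marking` — verbatim
`exists_antiInvariantFrame`, with the registered one-line signature (fully qualified names).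
[cite: VanGeemenSarti2007, §1.2 and §1.3] [cite: Morrison1984, Thm. 5.7] -/
theorem stub_anchorAntiInvariantFrame : ∀ {X : Literature.AlgebraicGeometry.Motives.SchemeOver ℂ} {ι : X ⟶ X}, Literature.AlgebraicGeometry.Surfaces.Nikulin_involution_marking → Literature.AlgebraicGeometry.Surfaces.IsK3Surface X → Literature.AlgebraicGeometry.Surfaces.IsNikulinInvolution X ι → ∃ (φ : Literature.AlgebraicGeometry.HodgeTheory.complexBetti X (2 * 1) ≃ₗ[ℂ] (Literature.AlgebraicGeometry.Surfaces.K3Index → ℂ)) (p : Literature.AlgebraicGeometry.HodgeTheory.complexBetti X (2 * 2)) (r : Fin 8 → Literature.AlgebraicGeometry.HodgeTheory.complexBetti X (2 * 1)), (Literature.AlgebraicGeometry.HodgeTheory.IsIntegralClass p ∧ (∀ q : Literature.AlgebraicGeometry.HodgeTheory.complexBetti X (2 * 2), Literature.AlgebraicGeometry.HodgeTheory.IsIntegralClass q → ∃ n : ℤ, q = n • p) ∧ (∀ c : Literature.AlgebraicGeometry.HodgeTheory.complexBetti X (2 * 1), Literature.AlgebraicGeometry.HodgeTheory.IsIntegralClass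 c ↔ ∃ v : Literature.AlgebraicGeometry.Surfaces.K3Index → ℤ, φ c = fun i ↦ (v i : ℂ)) ∧ (∀ a b : Literature.AlgebraicGeometry.HodgeTheory.complexBetti X (2 * 1), Literature.AlgebraicTopology.SingularHomology.cupProduct (rfl : 2 * 1 + 2 * 1 = 2 * 2) a b = Literature.AlgebraicGeometry.Surfaces.k3Form (φ a) (φ b) • p) ∧ ∀ c : Literature.AlgebraicGeometry.HodgeTheory.complexBetti X (2 * 1), φ (Literature.AlgebraicGeometry.HodgeTheory.complexBetti.map ι (2 * 1) c) = fun i ↦ φ c (Literature.AlgebraicGeometry.Surfaces.k3BlockSwap i)) ∧ (∀ j, Literature.AlgebraicGeometry.HodgeTheory.IsIntegralClass (r j)) ∧ (∀ j, Literature.AlgebraicGeometry.HodgeTheory.complexBetti.map ι (2 * 1) (r j) = -r j) ∧ (∀ i j, Literature.AlgebraicGeometry.Surfaces.k3Form (φ (r i)) (φ (r j)) = if i = j then -4 else 0) ∧ (∀ i j, Literature.AlgebraicTopology.SingularHomology.cupProduct (rfl : 2 * 1 + 2 * 1 = 2 * 2) (r i) (r j) = (if i = j then (-4 : ℂ) else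 0) • p) ∧ (∀ x : Literature.AlgebraicGeometry.HodgeTheory.complexBetti X (2 * 1), Literature.AlgebraicGeometry.HodgeTheory.complexBetti.map ι (2 * 1) x = -x → x ∈ Submodule.span ℂ (Set.range r)) ∧ (∀ (j : Fin 8) (w : Literature.AlgebraicGeometry.HodgeTheory.complexBetti X (2 * 1)), Literature.AlgebraicGeometry.HodgeTheory.complexBetti.map ι (2 * 1) w = w → Literature.AlgebraicGeometry.Surfaces.k3Form (φ (r j)) (φ w) = 0 ∧ Literature.AlgebraicGeometry.Surfaces.k3Form (φ w) (φ (r j)) = 0) :=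
  fun hNM hX hι ↦ exists_antiInvariantFrame hNM hX hι

end Summit.HodgeConjecture.HodgeConjecture.Theorems.NikulinSerreCarrier.NeronSeveriIntertwiner

end
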